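import Literature.MathematicalPhysics.QuantumFieldTheory.Balaban1983to89.Node00.BgSchemePrOfRecordLie
import Literature.MathematicalPhysics.QuantumFieldTheory.Balaban1983to89.Node00.BgSchemeOfRecordLie
import HarnessLib

/-!
# N07 at the record — THE CURED DOMAIN IS A NEIGHBOURHOOD OF THE AVERAGED BACKGROUND: `curedDomPrOfRecord … t ∈ 𝓝 (Ū^kU₀)` (framed, (A4)) and
# `{V | ‖𝔄♭V‖ < t} ∩ logDiscOfRecord k U₀ ∈ 𝓝 (Ū^kU₀)` (frame-free), for `0 < t` — def-Y's «NOT here» item of (A4) («needs the continuity of `B` on the log-disc»),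
# discharged BY NAME from (C3) ✓`isOpen_logPolydiscPrOfRecord` ∕ ✓`isOpen_logPolydiscOfRecord` (the cured domain is the preimage of the open log-polydisc of complex data
# under the continuous coefficient map `coeField`)

Cell `pub-ymgap`, seat `pub-ymgap-dag-n07-w3` (g28, WIDTH SEAT 3 on N07 [B11]); helper file keyed `--supports stmt-QuantumFields-27238 --as helper` (K0ᴬ road);
count-neutral.  INTENT-18 of the seat: the domain letter of LOCATED-g28-3's cure is OPEN and contains the base point, so the K0ᴬ road's `hdom`-clause
(«`∀ᶠ B in 𝓝 0, (datum map) B ∈ S.dom`») is available for `dom :=` the cured domain along any datum map continuous at the base.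

## What is here

* §1 (framed, any datum `𝔥`) `continuous_coeFieldSU`, ★ `mem_curedDomPrOfRecord_iff_coeField_mem` (`V ∈ curedDomPrOfRecord … t ↔ ↑V ∈ logPolydiscPrOfRecord … t`, (C2)
  ✓`frakAprOfRecordAtBg128C_coeField`), ★★ `isOpen_curedDomPrOfRecord`, ★★ `curedDomPrOfRecord_mem_nhds (ht : 0 < t)`, ★★ `eventually_mem_curedDomPrOfRecord` (along a map
  `u` continuous at `x₀` with `u x₀ = Ū^kU₀`).
* §2 (frame-free, the set `{V | ‖𝔄♭V‖ < t} ∩ logDiscOfRecord F N K k U₀` written inline — no `def`) ★ `mem_curedDomFlat_iff_coeField_mem`, ★★ `isOpen_curedDomFlat`,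
  ★★ `curedDomFlat_mem_nhds`, ★★ `eventually_mem_curedDomFlat`.
* §3 (v1.1, `U₀ = 1`) ★★ `curedDomPrOfRecord_mem_nhds_one` ∕ ★★ `curedDomFlat_mem_nhds_one` — `∈ 𝓝 1` (`Ū^k 1 = 1`), the shape ✓`eventually_unitField_mem (hd : dom ∈ 𝓝 1)` consumes.

## Honest labels

Topology bookkeeping on landed letters ((A4) `curedDomPrOfRecord`∕`logDiscOfRecord`, (C3)∕✓`BgSchemeOfRecordLie` log-polydiscs); nothing of Bałaban's estimates; K0ᴬ ⟨27238⟩ NOT closed;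
N07 NOT discharged; R4 is the conditional finite-𝕋⁴ rung `BalabanLadder.UV` only; finite torus at fixed `ε` — nothing continuum ∕ OS ∕ Clay.
**The Yang–Mills mass gap is NOT proved by any of this.**  No `sorry`, no `def`, no `instance ∕ notation`; standard axioms.
[cite: Balaban1985Variational, (7) p.279, (20) p.281, (103) p.293, Prop. 6 (115) p.295, Sect. G p.307]
-/

set_option autoImplicit false

noncomputable section

open scoped Matrix Matrix.Norms.L2Operator InnerProductSpace Topology

namespace Summit.QuantumFields.YangMills.Theorems.N07CuredDomNhds

open Filter
open Literature.MathematicalPhysics.QuantumFieldTheory.Balaban1983to89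
open Literature.MathematicalPhysics.QuantumFieldTheory.Balaban1983to89.T4Continuum (T4Family)
open Literature.MathematicalPhysics.QuantumFieldTheory.Balaban1983to89.Node00
open B11Eq103H1Complex (SiteL2K BondL2K)

section Record

variable (F : T4Family) (N : ℕ) [NeZero N] (K : ℕ) (k : ℕ) (Ω : ℕ → Set (Site (F.P K) 0)) (U₀ : GaugeField (F.P K) 0 (SU N))
  [Fact (0 < (F.L : ℝ))] [Fact (0 < (F.P K).eta k)] [Fact (0 < c0Rec F K k)] [Fact (∀ c, 0 < wBRec F K k c)]
  (𝔥 : FrameDatum (F.P K) N k U₀) (levB : PBond (F.P K) k → ℕ)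
  (Gp : SiteL2K ℂ (F.P K).d (fun _ => (F.P K).sitesPerDir 0) (c0Rec F K k) (WRec N) →ₗ[ℂ]
    SiteL2K ℂ (F.P K).d (fun _ => (F.P K).sitesPerDir 0) (c0Rec F K k) (WRec N))
  (Δ2 : BondL2K ℂ (F.P K).d (fun _ => (F.P K).sitesPerDir 0) (c0Rec F K k) (WRec N) →ₗ[ℂ]
    BondL2K ℂ (F.P K).d (fun _ => (F.P K).sitesPerDir 0) (c0Rec F K k) (WRec N)) (a : ℝ)

omit [NeZero N] [Fact (0 < (F.L : ℝ))] [Fact (0 < (F.P K).eta k)] [Fact (0 < c0Rec F K k)] [Fact (∀ c, 0 < wBRec F K k c)] in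
/-- The coefficient map `V ↦ ↑V` from `SU(N)` configurations to matrix fields is continuous. [cite: Balaban1985Variational, (7) p.279 (bookkeeping)] -/
theorem continuous_coeFieldSU {j : ℕ} : Continuous (coeField : GaugeField (F.P K) j (SU N) → PBond (F.P K) j → Matrix (Fin N) (Fin N) ℂ) := by
  refine continuous_pi fun c => ?_
  have h : (fun V : GaugeField (F.P K) j (SU N) => coeField V c) = fun V => ((V c : SU N) : Matrix (Fin N) (Fin N) ℂ) :=
    funext fun V => coeField_apply V c
  rw [h]
  exact continuous_subtype_val.comp (continuous_apply c)

/-! ## §1  Framed: `curedDomPrOfRecord … t` -/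

section Framed

variable (hposπ : ∀ x, x ≠ 0 → 0 < RCLike.re ⟪x, laplaceAOfRecordAt F N k U₀ (hessOpOfRecord128 F N k U₀ Gp (QprimeOfRecord F N k U₀) Δ2)
    (QprOfRecord F N k U₀ 𝔥) (QprimeOfRecord F N k U₀) a x⟫_ℂ)
  (hQ : Function.Surjective (QprOfRecord F N k U₀ 𝔥))

/-- ★ **THE CURED DOMAIN IS THE PREIMAGE OF THE LOG-POLYDISC OF COMPLEX DATA**: `V ∈ curedDomPrOfRecord … t ↔ ↑V ∈ logPolydiscPrOfRecord … t`
(`𝔄^{pr,ᶜ}(↑V) = 𝔄^{pr}(V)`, (C2) ✓`frakAprOfRecordAtBg128C_coeField`). [cite: Balaban1985Variational, (20) p.281, Prop. 6 (115) p.295, Sect. G p.307] -/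
theorem mem_curedDomPrOfRecord_iff_coeField_mem (t : ℝ) (V : GaugeField (F.P K) k (SU N)) :
    V ∈ curedDomPrOfRecord F N K k Ω U₀ 𝔥 levB Gp Δ2 a hposπ hQ t ↔
      coeField V ∈ logPolydiscPrOfRecord F N K k Ω U₀ 𝔥 levB Gp Δ2 a hposπ hQ t := by
  rw [mem_curedDomPrOfRecord_iff, mem_logDiscOfRecord_iff]
  constructor
  · rintro ⟨h𝔄, hlog⟩
    refine ⟨fun c => ?_, ?_⟩
    · rw [coeField_apply]; exact hlog c
    · show ‖frakAprOfRecordAtBg128C F N K k Ω U₀ 𝔥 levB Gp Δ2 a hposπ hQ (coeField V)‖ < t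
      rw [frakAprOfRecordAtBg128C_coeField]; exact h𝔄
  · rintro ⟨hlog, h𝔄⟩
    refine ⟨?_, fun c => ?_⟩
    · have h' : ‖frakAprOfRecordAtBg128C F N K k Ω U₀ 𝔥 levB Gp Δ2 a hposπ hQ (coeField V)‖ < t := h𝔄
      rwa [frakAprOfRecordAtBg128C_coeField] at h'
    · have h' := hlog c
      rwa [coeField_apply] at h'

/-- ★★ **THE CURED DOMAIN IS OPEN**. [cite: Balaban1985Variational, (7) p.279, (20) p.281, Sect. G p.307] -/
theorem isOpen_curedDomPrOfRecord (t : ℝ) : IsOpen (curedDomPrOfRecord F N K k Ω U₀ 𝔥 levB Gp Δ2 a hposπ hQ t) := by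
  have h : curedDomPrOfRecord F N K k Ω U₀ 𝔥 levB Gp Δ2 a hposπ hQ t =
      coeField ⁻¹' logPolydiscPrOfRecord F N K k Ω U₀ 𝔥 levB Gp Δ2 a hposπ hQ t :=
    Set.ext fun V => mem_curedDomPrOfRecord_iff_coeField_mem F N K k Ω U₀ 𝔥 levB Gp Δ2 a hposπ hQ t V
  rw [h]
  exact (isOpen_logPolydiscPrOfRecord F N K k Ω U₀ 𝔥 levB Gp Δ2 a hposπ hQ t).preimage (continuous_coeFieldSU F N K)

/-- ★★ **THE CURED DOMAIN IS A NEIGHBOURHOOD OF THE AVERAGED BACKGROUND** for `0 < t` (def-Y's «NOT here» item of (A4), by name). [cite: Balaban1985Variational, (7) p.279, (20) p.281, (103) p.293] -/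
theorem curedDomPrOfRecord_mem_nhds {t : ℝ} (ht : 0 < t) :
    curedDomPrOfRecord F N K k Ω U₀ 𝔥 levB Gp Δ2 a hposπ hQ t ∈ 𝓝 (Averaging.iter (avOfRecord F N K) k U₀) :=
  (isOpen_curedDomPrOfRecord F N K k Ω U₀ 𝔥 levB Gp Δ2 a hposπ hQ t).mem_nhds (iter_mem_curedDomPrOfRecord F N K k Ω U₀ 𝔥 levB Gp Δ2 a hposπ hQ ht)

/-- ★★ **EVENTUAL MEMBERSHIP ALONG A DATUM MAP**: if `u` is continuous at `x₀` with `u x₀ = Ū^kU₀`, then `u x ∈ curedDomPrOfRecord … t` for `x` near `x₀` (the K0ᴬ road's `hdom` clause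
for `dom :=` the cured domain). [cite: Balaban1985Variational, (7) p.279, (20) p.281] -/
theorem eventually_mem_curedDomPrOfRecord {t : ℝ} (ht : 0 < t) {E : Type*} [TopologicalSpace E] {u : E → GaugeField (F.P K) k (SU N)} {x₀ : E}
    (hu : ContinuousAt u x₀) (hx₀ : u x₀ = Averaging.iter (avOfRecord F N K) k U₀) :
    ∀ᶠ x in 𝓝 x₀, u x ∈ curedDomPrOfRecord F N K k Ω U₀ 𝔥 levB Gp Δ2 a hposπ hQ t := by
  have h := curedDomPrOfRecord_mem_nhds F N K k Ω U₀ 𝔥 levB Gp Δ2 a hposπ hQ ht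
  rw [← hx₀] at h
  exact hu.preimage_mem_nhds h

end Framed

/-! ## §2  Frame-free: `{V | ‖𝔄♭V‖ < t} ∩ logDiscOfRecord F N K k U₀` -/

section Flat

variable (hposπ : ∀ x, x ≠ 0 → 0 < RCLike.re ⟪x, laplaceAOfRecordAt F N k U₀ (hessOpOfRecord128 F N k U₀ Gp (QflatOfRecord F N k) Δ2)
    (QOfRecord F N k U₀) (QflatOfRecord F N k) a x⟫_ℂ)
  (hQ : Function.Surjective (QOfRecord F N k U₀))

/-- ★ **THE FRAME-FREE CURED DOMAIN IS THE PREIMAGE OF ✓`logPolydiscOfRecord`** (`𝔄ᶜ(↑V) = 𝔄♭(V)`, ✓`frakAOfRecordAtBg128C_coeField`). [cite: Balaban1985Variational, (20) p.281, Prop. 6 (115) p.295] -/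
theorem mem_curedDomFlat_iff_coeField_mem (t : ℝ) (V : GaugeField (F.P K) k (SU N)) :
    V ∈ {V : GaugeField (F.P K) k (SU N) | ‖frakAOfRecordAtBg128 F N K k Ω U₀ levB Gp Δ2 a hposπ hQ V‖ < t} ∩ logDiscOfRecord F N K k U₀ ↔
      coeField V ∈ logPolydiscOfRecord F N K k Ω U₀ levB Gp Δ2 a hposπ hQ t := by
  rw [Set.mem_inter_iff, Set.mem_setOf_eq, mem_logDiscOfRecord_iff]
  constructor
  · rintro ⟨h𝔄, hlog⟩
    refine ⟨fun c => ?_, ?_⟩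
    · rw [coeField_apply]; exact hlog c
    · show ‖frakAOfRecordAtBg128C F N K k Ω U₀ levB Gp Δ2 a hposπ hQ (coeField V)‖ < t
      rw [frakAOfRecordAtBg128C_coeField]; exact h𝔄
  · rintro ⟨hlog, h𝔄⟩
    refine ⟨?_, fun c => ?_⟩
    · have h' : ‖frakAOfRecordAtBg128C F N K k Ω U₀ levB Gp Δ2 a hposπ hQ (coeField V)‖ < t := h𝔄
      rwa [frakAOfRecordAtBg128C_coeField] at h'
    · have h' := hlog c
      rwa [coeField_apply] at h'

/-- ★★ **THE FRAME-FREE CURED DOMAIN IS OPEN**. [cite: Balaban1985Variational, (7) p.279, (20) p.281, Sect. G p.307] -/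
theorem isOpen_curedDomFlat (t : ℝ) :
    IsOpen ({V : GaugeField (F.P K) k (SU N) | ‖frakAOfRecordAtBg128 F N K k Ω U₀ levB Gp Δ2 a hposπ hQ V‖ < t} ∩ logDiscOfRecord F N K k U₀) := by
  have h : {V : GaugeField (F.P K) k (SU N) | ‖frakAOfRecordAtBg128 F N K k Ω U₀ levB Gp Δ2 a hposπ hQ V‖ < t} ∩ logDiscOfRecord F N K k U₀ =
      coeField ⁻¹' logPolydiscOfRecord F N K k Ω U₀ levB Gp Δ2 a hposπ hQ t :=
    Set.ext fun V => mem_curedDomFlat_iff_coeField_mem F N K k Ω U₀ levB Gp Δ2 a hposπ hQ t V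
  rw [h]
  exact (isOpen_logPolydiscOfRecord F N K k Ω U₀ levB Gp Δ2 a hposπ hQ t).preimage (continuous_coeFieldSU F N K)

/-- ★★ **THE FRAME-FREE CURED DOMAIN IS A NEIGHBOURHOOD OF `Ū^kU₀`** for `0 < t`. [cite: Balaban1985Variational, (7) p.279, (20) p.281, (103) p.293] -/
theorem curedDomFlat_mem_nhds {t : ℝ} (ht : 0 < t) :
    {V : GaugeField (F.P K) k (SU N) | ‖frakAOfRecordAtBg128 F N K k Ω U₀ levB Gp Δ2 a hposπ hQ V‖ < t} ∩ logDiscOfRecord F N K k U₀ ∈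
      𝓝 (Averaging.iter (avOfRecord F N K) k U₀) := by
  refine (isOpen_curedDomFlat F N K k Ω U₀ levB Gp Δ2 a hposπ hQ t).mem_nhds ?_
  rw [mem_curedDomFlat_iff_coeField_mem]
  exact coeField_iter_mem_logPolydiscOfRecord F N K k Ω U₀ levB Gp Δ2 a hposπ hQ t ht

/-- ★★ **EVENTUAL MEMBERSHIP ALONG A DATUM MAP, FRAME-FREE**: `u` continuous at `x₀` with `u x₀ = Ū^kU₀` ⟹ `u x` lies in the frame-free cured domain for `x` near `x₀`.
[cite: Balaban1985Variational, (7) p.279, (20) p.281] -/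
theorem eventually_mem_curedDomFlat {t : ℝ} (ht : 0 < t) {E : Type*} [TopologicalSpace E] {u : E → GaugeField (F.P K) k (SU N)} {x₀ : E}
    (hu : ContinuousAt u x₀) (hx₀ : u x₀ = Averaging.iter (avOfRecord F N K) k U₀) :
    ∀ᶠ x in 𝓝 x₀, u x ∈ {V : GaugeField (F.P K) k (SU N) | ‖frakAOfRecordAtBg128 F N K k Ω U₀ levB Gp Δ2 a hposπ hQ V‖ < t} ∩ logDiscOfRecord F N K k U₀ := by
  have h := curedDomFlat_mem_nhds F N K k Ω U₀ levB Gp Δ2 a hposπ hQ ht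
  rw [← hx₀] at h
  exact hu.preimage_mem_nhds h

end Flat

/-! ## §3 (v1.1)  At the unit background `U₀ = 1`: the cured domains are neighbourhoods of `1` (`Ū^k 1 = 1`) — the shape the K0ᴬ road's `hdom` letter consumes
(✓`K0AxSchemeOfRecordLetters.eventually_unitField_mem (hd : dom ∈ 𝓝 1)`) -/

section One

variable (𝔥₁ : FrameDatum (F.P K) N k (1 : GaugeField (F.P K) 0 (SU N)))
  (hposπ₁ : ∀ x, x ≠ 0 → 0 < RCLike.re ⟪x, laplaceAOfRecordAt F N k (1 : GaugeField (F.P K) 0 (SU N))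
    (hessOpOfRecord128 F N k (1 : GaugeField (F.P K) 0 (SU N)) Gp (QprimeOfRecord F N k (1 : GaugeField (F.P K) 0 (SU N))) Δ2)
    (QprOfRecord F N k (1 : GaugeField (F.P K) 0 (SU N)) 𝔥₁) (QprimeOfRecord F N k (1 : GaugeField (F.P K) 0 (SU N))) a x⟫_ℂ)
  (hQ₁ : Function.Surjective (QprOfRecord F N k (1 : GaugeField (F.P K) 0 (SU N)) 𝔥₁))

/-- ★★ **AT `U₀ = 1` THE FRAMED CURED DOMAIN IS A NEIGHBOURHOOD OF THE UNIT CONFIGURATION** (`Ū^k 1 = 1`, ✓`avOfRecord_iter_one`) — feed it to ✓`eventually_unitField_mem`.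
[cite: Balaban1985Variational, (7) p.279, (20) p.281] -/
theorem curedDomPrOfRecord_mem_nhds_one {t : ℝ} (ht : 0 < t) :
    curedDomPrOfRecord F N K k Ω (1 : GaugeField (F.P K) 0 (SU N)) 𝔥₁ levB Gp Δ2 a hposπ₁ hQ₁ t ∈ 𝓝 (1 : GaugeField (F.P K) k (SU N)) := by
  have h := curedDomPrOfRecord_mem_nhds F N K k Ω (1 : GaugeField (F.P K) 0 (SU N)) 𝔥₁ levB Gp Δ2 a hposπ₁ hQ₁ ht
  rwa [avOfRecord_iter_one] at h

end One

section OneFlat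

variable (hposπ₁ : ∀ x, x ≠ 0 → 0 < RCLike.re ⟪x, laplaceAOfRecordAt F N k (1 : GaugeField (F.P K) 0 (SU N))
    (hessOpOfRecord128 F N k (1 : GaugeField (F.P K) 0 (SU N)) Gp (QflatOfRecord F N k) Δ2)
    (QOfRecord F N k (1 : GaugeField (F.P K) 0 (SU N))) (QflatOfRecord F N k) a x⟫_ℂ)
  (hQ₁ : Function.Surjective (QOfRecord F N k (1 : GaugeField (F.P K) 0 (SU N))))

/-- ★★ **AT `U₀ = 1` THE FRAME-FREE CURED DOMAIN IS A NEIGHBOURHOOD OF THE UNIT CONFIGURATION** (`Ū^k 1 = 1`). [cite: Balaban1985Variational, (7) p.279, (20) p.281] -/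
theorem curedDomFlat_mem_nhds_one {t : ℝ} (ht : 0 < t) :
    {V : GaugeField (F.P K) k (SU N) | ‖frakAOfRecordAtBg128 F N K k Ω (1 : GaugeField (F.P K) 0 (SU N)) levB Gp Δ2 a hposπ₁ hQ₁ V‖ < t} ∩
        logDiscOfRecord F N K k (1 : GaugeField (F.P K) 0 (SU N)) ∈ 𝓝 (1 : GaugeField (F.P K) k (SU N)) := by
  have h := curedDomFlat_mem_nhds F N K k Ω (1 : GaugeField (F.P K) 0 (SU N)) levB Gp Δ2 a hposπ₁ hQ₁ ht
  rwa [avOfRecord_iter_one] at h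

end OneFlat

end Record

end Summit.QuantumFields.YangMills.Theorems.N07CuredDomNhds

end
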